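import Summits.BirchSwinnertonDyer.BirchSwinnertonDyer.Theorems.ByReductionTypeAtTwoFineSelmerConjAAtTwoAdditivePotGoodTwoLayerDoor
import Summits.BirchSwinnertonDyer.BirchSwinnertonDyer.Theorems.ByReductionTypeAtTwoFineSelmerConjAAtTwoAdditivePotGoodClassNumberOne780
import HarnessLib

/-!
# Route `ByReductionTypeAtTwo` (rung K4), crux C1″ `FineSelmerConjAAtTwoAdditivePotGood` (item stmt-BirchSwinnertonDyer-22615):
# FIRST TWO-LAYER STAMPS — census rows `293200be1` (this title) and `412992bw1` (§4); `293200be1`: (`2 = 𝔭₁𝔭₂` in the cubic field `F` of discriminant `733`, a `C1″-RES` row):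
# `h(F) = 1` BY AN EXPLICIT MINKOWSKI CERTIFICATE (kernel), Fukuda's index `0` (kernel), so (A)₂ holds modulo `hLim2` and
# ONE displayed bit — the parity of `h(F(√2))` (census: `Cl(F(√2)) = []`)
# (a `--supports 22615` file; seat `bsd-2adic-k4-w1` GEN 5; first consumer of `…TwoLayerDoor`)

HONEST FRAMING (cell `bsd-2adic`, D-0036/D-0054/D-0152): per-class stamp; conditional on `hLim2` (Lim 2017 Thm. 3.5 at `2`) BY NAME and on ONE
displayed bit «`e_1 = 0` along the cyclotomic `ℤ₂`-extensions of `F = ℚ(θ)`», i.e. `2 ∤ h(F(√2))` (`…TwoLayerDoor` §2; census value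
`cyc6 = []` in `addL2x/gen5/conjA2_census_j289938_classes.tsv`, PARI under GRH — NOT kernel). Everything else (irreducibility, `d_F` odd,
`h(F) = 1`, the identification `ℚ(P) = ℚ(θ)`, Fukuda's index, Fukuda's theorem) is KERNEL. Closes nothing at the `∀`-level; nothing booked;
BSD is not proved by any of this. THIS MOVES ROW `293200be1` FROM `C1″-RES` (conjecture-grade) TO THE DOOR SIDE (one parity bit).

THE FIELD. `293200be1 = [0, 1, 0, −3388217033, −75912170159062]`; its `2`-division cubic `X³ + X² − 3388217033X − 75912170159062` (disc
`733·5¹²`) generates the totally real cubic field `F` of discriminant `733` = `ℚ(θ)`, `θ³ − θ² − 7θ + 8 = 0` (disc `733`, prime, odd ⟹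
`2` unramified: `2 = 𝔭₁𝔭₂`, `X³ − X² − 7X + 8 ≡ X(X² + X + 1) (mod 2)`): indeed `β = −18802 − 18445θ + 4990θ²` is a root of the
`2`-division cubic and `θ = (−2254304911498 − 33538753β + 998β²)/3125` (both identities are `linear_combination`s, found numerically by the
seat's `gen/cubictool.py` over three real embeddings and verified here exactly).

THE CERTIFICATE (`M_F ≤ (4/3.14)(6/27)√733 < 8`; `g = X³ − X² − 7X + 8` has no root mod `3`, so it is irreducible). Every prime ideal `I`
with `N(I) ≤ 7` is principal: `N(I) = 2`: `θ ∈ I` (`2 ∣ g(a)` only for `a = 0`), `α₂ = θ − 2 ∈ I`, `N(α₂) = 2`; `N(I) = 3`: impossible;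
`N(I) = 4`: `2 ∈ I` and `θ(θ² + θ + 1) = 2(θ² + 4θ − 4) ∈ I`, so `θ ∈ I` (then `N(I) ∣ N(α₂) = 2`, absurd) or `θ² + θ + 1 ∈ I`, and then
`α₄ = θ² + θ − 3 = −3(θ² + θ + 1) + 2(2θ² + 2θ) ∈ I`, `N(α₄) = −4`, `I = (α₄)`; `N(I) = 5`: `θ ≡ 3`, `α₅ = θ − 3`, `N = −5`; `N(I) = 6`:
impossible; `N(I) = 7`: `θ ≡ 4`, `α₇ = −3 − θ = −(θ − 4) − 7`, `N = −7`.

* §1 `irreducible_cubic_disc_733`, **`classNumber_eq_one_of_root_disc_733`**, `card_classGroup_adjoin_eq_one_disc_733`;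
* §2 **`classicalMuVanishes_cubicField_disc_733_of_layerOne`**: `μ₂ = 0` along every CYCLOTOMIC `ℤ₂`-extension of `ℚ(θ)` granted the
  single bit `e_1 = 0` — the first `S₃`-cubic field with TWO primes above `2` reached by the kernel side;
* §3 **`conjA_two_293200be1_of_layerOneBit`**: (A)₂ for `293200be1` from `hLim2` + that bit.
* §4 **`conjA_two_412992bw1_of_twoBits`**: the second `𝔭₁𝔭₂` row `412992bw1` (field of discriminant `6453 = 3³·239`, `ℚ(θ)` with
  `θ³ = 18θ + 25`; `h = 1` in print, displayed here as the bit `2 ∤ #Cl`) from `hLim2` + TWO bits.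

References: [Fukuda1994] Thm. 1 (1); [Lim2017FineSelmer] Thm. 3.5, Lemma 3.2; [CoatesSujatha2005] (A); [Marcus1977] Ch. 5 Thm. 37, Cor. 2;
[Cohen1993] §6.3, App. B (totally real cubic fields: d = 733, h = 1); cell TSV `addL2x/gen5/conjA2_census_j289938_classes.tsv` (row 293200be1:
dF3 = 733, dec2inF3 = e1f1,e1f2, cyc3 = [], cyc6 = [], ramK6 = 1).
-/

set_option autoImplicit false
-- sibling precedent (`…ClassNumberOne780.lean`): the directory name repeats the summit name
set_option linter.dupNamespace false

noncomputable section

open scoped Classical IntermediateField NumberField Real nonZeroDivisors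

namespace Summit.BirchSwinnertonDyer.BirchSwinnertonDyer.Theorems.AddKatoTwo

open WeierstrassCurve Field Polynomial IsDedekindDomain NumberField Matrix Literature.NumberTheory.EllipticCurves
  Literature.NumberTheory.GaloisRepresentations
  Literature.NumberTheory.IwasawaTheory
  Summit.BirchSwinnertonDyer.BirchSwinnertonDyer.Theorems.AlignedTransportAtTwoTorsionPointField
  Summit.BirchSwinnertonDyer.BirchSwinnertonDyer.Theses.ByReductionTypeAtTwo

/-! ## §1 The field of discriminant `733`: irreducibility and class number one -/

/-- `X³ − X² − 7X + 8` is irreducible over `ℚ` (no root mod `3`). -/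
theorem irreducible_cubic_disc_733 : Irreducible (Cubic.toPoly ⟨1, ((-1 : ℤ) : ℚ), ((-7 : ℤ) : ℚ), ((8 : ℤ) : ℚ)⟩) :=
  haveI : Fact (Nat.Prime 3) := ⟨by norm_num⟩
  irreducible_cubic_of_no_root_zmod 3 (by decide)

section Certificate

variable (K : Type) [Field K] [NumberField K]

/-- The companion-determinant norms of the generators `θ − 2`, `θ² + θ − 3`, `θ − 3`, `−3 − θ` of the field of `X³ − X² − 7X + 8`:
`2, −4, −5, −7`. -/
private theorem dets_disc_733 :
    (((-2 : ℤ) : ℚ) • (1 : Matrix (Fin 3) (Fin 3) ℚ) + ((1 : ℤ) : ℚ) • !![(0 : ℚ), 0, -(8 : ℤ); 1, 0, -(-7 : ℤ); 0, 1, -(-1 : ℤ)] +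
        ((0 : ℤ) : ℚ) • !![(0 : ℚ), 0, -(8 : ℤ); 1, 0, -(-7 : ℤ); 0, 1, -(-1 : ℤ)] ^ 2).det = 2 ∧
    (((-3 : ℤ) : ℚ) • (1 : Matrix (Fin 3) (Fin 3) ℚ) + ((1 : ℤ) : ℚ) • !![(0 : ℚ), 0, -(8 : ℤ); 1, 0, -(-7 : ℤ); 0, 1, -(-1 : ℤ)] +
        ((1 : ℤ) : ℚ) • !![(0 : ℚ), 0, -(8 : ℤ); 1, 0, -(-7 : ℤ); 0, 1, -(-1 : ℤ)] ^ 2).det = -4 ∧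
    (((-3 : ℤ) : ℚ) • (1 : Matrix (Fin 3) (Fin 3) ℚ) + ((1 : ℤ) : ℚ) • !![(0 : ℚ), 0, -(8 : ℤ); 1, 0, -(-7 : ℤ); 0, 1, -(-1 : ℤ)] +
        ((0 : ℤ) : ℚ) • !![(0 : ℚ), 0, -(8 : ℤ); 1, 0, -(-7 : ℤ); 0, 1, -(-1 : ℤ)] ^ 2).det = -5 ∧
    (((-3 : ℤ) : ℚ) • (1 : Matrix (Fin 3) (Fin 3) ℚ) + ((-1 : ℤ) : ℚ) • !![(0 : ℚ), 0, -(8 : ℤ); 1, 0, -(-7 : ℤ); 0, 1, -(-1 : ℤ)] +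
        ((0 : ℤ) : ℚ) • !![(0 : ℚ), 0, -(8 : ℤ); 1, 0, -(-7 : ℤ); 0, 1, -(-1 : ℤ)] ^ 2).det = -7 := by
  refine ⟨?_, ?_, ?_, ?_⟩ <;> · simp [Matrix.det_fin_three, sq]; norm_num

/-- **`h = 1` for every cubic number field containing a root `θ` of `X³ − X² − 7X + 8`** (the totally real field of discriminant
`733`, `2 = 𝔭₁𝔭₂`), by the explicit Minkowski certificate of the module docstring. KERNEL. [cite: Marcus1977, Ch. 5 Thm. 37 and Cor. 2]
[cite: Cohen1993, App. B (totally real cubic fields: d = 733, h = 1)] -/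
theorem classNumber_eq_one_of_root_disc_733 (h3 : Module.finrank ℚ K = 3) (b : 𝓞 K)
    (hb : b ^ 3 + (-1 : ℤ) * b ^ 2 + (-7 : ℤ) * b + (8 : ℤ) = 0) : NumberField.classNumber K = 1 := by
  have hirr := irreducible_cubic_disc_733
  have hd : |NumberField.discr K| ≤ (733 : ℕ) :=
    (abs_discr_le_abs_cubic_discr K h3 b hirr hb).trans (by simp only [Cubic.discr]; norm_num)
  have hM := minkowskiBound_lt_of_sqrt_le K h3 hd (s := 27.08) (B := 8)
    ((Real.sqrt_le_sqrt (by norm_num : ((733 : ℕ) : ℝ) ≤ (27.08 : ℝ) ^ 2)).trans (Real.sqrt_sq (by norm_num)).le)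
    (by norm_num)
  obtain ⟨hN2, hN4, hN5, hN7⟩ := dets_disc_733
  have hb' : b ^ 3 - b ^ 2 - 7 * b + 8 = 0 := by push_cast at hb; linear_combination hb
  rw [NumberField.classNumber_eq_one_iff]
  refine RingOfIntegers.isPrincipalIdealRing_of_isPrincipal_of_norm_le_of_isPrime fun I hI hle ↦ ?_
  have hlt : Ideal.absNorm (I : Ideal (𝓞 K)) < 8 := by exact_mod_cast hle.trans_lt hM
  have h0 : Ideal.absNorm (I : Ideal (𝓞 K)) ≠ 0 := Ideal.absNorm_ne_zero_of_nonZeroDivisors I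
  have h1 : Ideal.absNorm (I : Ideal (𝓞 K)) ≠ 1 := by rw [Ne, Ideal.absNorm_eq_one_iff]; exact hI.ne_top
  have hmemN := Ideal.absNorm_mem (I : Ideal (𝓞 K))
  -- norms of the generators
  have nα2 := natAbs_norm_coords_eq K h3 b hirr hb (-2) 1 0 (n := 2) hN2 (by norm_num)
  have nα4 := natAbs_norm_coords_eq K h3 b hirr hb (-3) 1 1 (n := 4) hN4 (by norm_num)
  have nα5 := natAbs_norm_coords_eq K h3 b hirr hb (-3) 1 0 (n := 5) hN5 (by norm_num)
  have nα7 := natAbs_norm_coords_eq K h3 b hirr hb (-3) (-1) 0 (n := 7) hN7 (by norm_num)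
  -- `θ ∈ I ⟹ α₂ = θ − 2 ∈ I` when `2 ∈ I`
  have key2 : ((2 : ℕ) : 𝓞 K) ∈ (I : Ideal (𝓞 K)) → b ∈ (I : Ideal (𝓞 K)) →
      (((-2 : ℤ) : 𝓞 K) + ((1 : ℤ) : 𝓞 K) * b + ((0 : ℤ) : 𝓞 K) * b ^ 2) ∈ (I : Ideal (𝓞 K)) := by
    intro h2 hbI
    have : (((-2 : ℤ) : 𝓞 K) + ((1 : ℤ) : 𝓞 K) * b + ((0 : ℤ) : 𝓞 K) * b ^ 2) = b + ((2 : ℕ) : 𝓞 K) * (-1) := by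
      push_cast; ring
    rw [this]
    exact Ideal.add_mem _ hbI (Ideal.mul_mem_right _ _ h2)
  have h2le : 2 ≤ Ideal.absNorm (I : Ideal (𝓞 K)) := by omega
  interval_cases hn : Ideal.absNorm (I : Ideal (𝓞 K))
  · -- N(I) = 2: `θ ≡ a`, `2 ∣ g(a)` forces `a = 0`
    have h2 : ((2 : ℕ) : 𝓞 K) ∈ (I : Ideal (𝓞 K)) := hmemN
    obtain ⟨a, ha, hab⟩ := exists_sub_natCast_mem_of_absNorm_eq_prime K (by norm_num) hn b
    have hdvd := natCast_dvd_of_sub_mem K (by norm_num) hn h3 hb hab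
    interval_cases a
    · refine ⟨⟨_, eq_span_singleton_of_mem_of_absNorm_eq K two_ne_zero hn (key2 h2 ?_) nα2⟩⟩
      simpa using hab
    · norm_num at hdvd
  · -- N(I) = 3: impossible (no root mod 3)
    exfalso
    obtain ⟨a, ha, hab⟩ := exists_sub_natCast_mem_of_absNorm_eq_prime K (by norm_num) hn b
    have hdvd := natCast_dvd_of_sub_mem K (by norm_num) hn h3 hb hab
    interval_cases a <;> norm_num at hdvd
  · -- N(I) = 4: `2 ∈ I`; `θ(θ² + θ + 1) = 2(θ² + 4θ − 4) ∈ I`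
    have h4 : ((4 : ℕ) : 𝓞 K) ∈ (I : Ideal (𝓞 K)) := hmemN
    have h2 : ((2 : ℕ) : 𝓞 K) ∈ (I : Ideal (𝓞 K)) := by
      have : ((4 : ℕ) : 𝓞 K) = ((2 : ℕ) : 𝓞 K) * ((2 : ℕ) : 𝓞 K) := by push_cast; norm_num
      rw [this] at h4
      exact (hI.mem_or_mem h4).elim id id
    have hprod : b * (b ^ 2 + b + 1) ∈ (I : Ideal (𝓞 K)) := by
      have : b * (b ^ 2 + b + 1) = ((2 : ℕ) : 𝓞 K) * (b ^ 2 + 4 * b - 4) := by push_cast; linear_combination hb'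
      rw [this]; exact Ideal.mul_mem_right _ _ h2
    rcases hI.mem_or_mem hprod with hbI | hqI
    · -- `θ ∈ I`: then `N(I) ∣ N(α₂) = 2`
      exfalso
      have hdvd := Ideal.absNorm_dvd_absNorm_of_le ((Ideal.span_singleton_le_iff_mem _).mpr (key2 h2 hbI))
      rw [Ideal.absNorm_span_singleton, nα2, hn] at hdvd
      omega
    · refine ⟨⟨_, eq_span_singleton_of_mem_of_absNorm_eq K (by norm_num) hn ?_ nα4⟩⟩
      have : (((-3 : ℤ) : 𝓞 K) + ((1 : ℤ) : 𝓞 K) * b + ((1 : ℤ) : 𝓞 K) * b ^ 2) =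
          (b ^ 2 + b + 1) * (-3) + ((2 : ℕ) : 𝓞 K) * (2 * b ^ 2 + 2 * b) := by push_cast; ring
      rw [this]
      exact Ideal.add_mem _ (Ideal.mul_mem_right _ _ hqI) (Ideal.mul_mem_right _ _ h2)
  · -- N(I) = 5: `θ ≡ 3`
    obtain ⟨a, ha, hab⟩ := exists_sub_natCast_mem_of_absNorm_eq_prime K (by norm_num) hn b
    have hdvd := natCast_dvd_of_sub_mem K (by norm_num) hn h3 hb hab
    interval_cases a
    · norm_num at hdvd
    · norm_num at hdvd
    · norm_num at hdvd
    · refine ⟨⟨_, eq_span_singleton_of_mem_of_absNorm_eq K (by norm_num) hn ?_ nα5⟩⟩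
      have : (((-3 : ℤ) : 𝓞 K) + ((1 : ℤ) : 𝓞 K) * b + ((0 : ℤ) : 𝓞 K) * b ^ 2) = b - ((3 : ℕ) : 𝓞 K) := by
        push_cast; ring
      rw [this]; exact hab
    · norm_num at hdvd
  · -- N(I) = 6: impossible
    exfalso
    have h6 : ((6 : ℕ) : 𝓞 K) ∈ (I : Ideal (𝓞 K)) := hmemN
    have : ((6 : ℕ) : 𝓞 K) = ((2 : ℕ) : 𝓞 K) * ((3 : ℕ) : 𝓞 K) := by push_cast; norm_num
    rw [this] at h6
    rcases hI.mem_or_mem h6 with h | h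
    · have := absNorm_dvd_pow_three_of_natCast_mem K h3 h; rw [hn] at this; omega
    · have := absNorm_dvd_pow_three_of_natCast_mem K h3 h; rw [hn] at this; omega
  · -- N(I) = 7: `θ ≡ 4`, `α₇ = −3 − θ = −(θ − 4) − 7`
    have h7m : ((7 : ℕ) : 𝓞 K) ∈ (I : Ideal (𝓞 K)) := hmemN
    obtain ⟨a, ha, hab⟩ := exists_sub_natCast_mem_of_absNorm_eq_prime K (by norm_num) hn b
    have hdvd := natCast_dvd_of_sub_mem K (by norm_num) hn h3 hb hab
    interval_cases a
    · norm_num at hdvd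
    · norm_num at hdvd
    · norm_num at hdvd
    · norm_num at hdvd
    · refine ⟨⟨_, eq_span_singleton_of_mem_of_absNorm_eq K (by norm_num) hn ?_ nα7⟩⟩
      have : (((-3 : ℤ) : 𝓞 K) + ((-1 : ℤ) : 𝓞 K) * b + ((0 : ℤ) : 𝓞 K) * b ^ 2) =
          (b - ((4 : ℕ) : 𝓞 K)) * (-1) + ((7 : ℕ) : 𝓞 K) * (-1) := by push_cast; ring
      rw [this]; exact Ideal.add_mem _ (Ideal.mul_mem_right _ _ hab) (Ideal.mul_mem_right _ _ h7m)
    · norm_num at hdvd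
    · norm_num at hdvd

end Certificate

/-- `#Cl(𝓞 ℚ(θ)) = 1` for every root `θ` of `X³ − X² − 7X + 8`. KERNEL. [cite: Cohen1993, App. B (d = 733)] -/
theorem card_classGroup_adjoin_eq_one_disc_733 {θ : AlgebraicClosure ℚ}
    (hθ : aeval θ (Cubic.toPoly ⟨1, ((-1 : ℤ) : ℚ), ((-7 : ℤ) : ℚ), ((8 : ℤ) : ℚ)⟩) = 0) :
    Nat.card (ClassGroup (𝓞 (IntermediateField.adjoin ℚ {θ}))) = 1 := by
  have hfm : (Cubic.toPoly ⟨1, ((-1 : ℤ) : ℚ), ((-7 : ℤ) : ℚ), ((8 : ℤ) : ℚ)⟩).Monic := Cubic.monic_of_a_eq_one'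
  have hθint : IsIntegral ℚ θ := ⟨_, hfm, by rwa [← aeval_def]⟩
  haveI : FiniteDimensional ℚ (IntermediateField.adjoin ℚ {θ}) := IntermediateField.adjoin.finiteDimensional hθint
  haveI : NumberField (IntermediateField.adjoin ℚ {θ}) := NumberField.mk
  obtain ⟨b, -, hb⟩ := exists_ringOfIntegers_cubic_root (p := -1) (q := -7) (r := 8) hθ
  have h1 := classNumber_eq_one_of_root_disc_733 _
    (finrank_adjoin_eq_three_of_irreducible irreducible_cubic_disc_733 hθ) b hb
  rw [NumberField.classNumber, ← Nat.card_eq_fintype_card] at h1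
  exact h1

/-! ## §2 `μ₂ = 0` for the field of discriminant `733` from ONE bit -/

/-- **Iwasawa's `μ₂ = 0` for the cubic field of discriminant `733`** (`ℚ(θ)`, `θ³ = θ² + 7θ − 8`; `2 = 𝔭₁𝔭₂`, two primes above `2`, so
Iwasawa 1956 does NOT apply) along every CYCLOTOMIC `ℤ₂`-extension `κ`, GRANTED ONE BIT: `e_1(κ) = 0`, i.e. `2 ∤ h(ℚ(θ, √2))` (census:
`Cl = []`). `h(ℚ(θ)) = 1` and Fukuda's index `0` are kernel; Fukuda's Thm. 1 (1) is the tree's discharged fact. The first `S₃`-cubic field with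
two primes above `2` on the kernel side of C1″. [cite: Fukuda1994, Thm. 1 (1), p. 264] [cite: Cohen1993, App. B (d = 733)] -/
theorem classicalMuVanishes_cubicField_disc_733_of_layerOne {θ : AlgebraicClosure ℚ}
    (hθ : aeval θ (Cubic.toPoly ⟨1, ((-1 : ℤ) : ℚ), ((-7 : ℤ) : ℚ), ((8 : ℤ) : ℚ)⟩) = 0)
    (κ : ZpExtension (IntermediateField.adjoin ℚ {θ}) 2) (hκ : κ.IsCyclotomic) (h1 : classNumberPExp κ 1 = 0) :
    ClassicalMuVanishes κ :=
  classicalMuVanishes_two_adjoin_of_odd_cubic_discr irreducible_cubic_disc_733 (by simp only [Cubic.discr]; norm_num) hθ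
    (by rw [card_classGroup_adjoin_eq_one_disc_733 hθ]; norm_num) κ hκ h1

/-! ## §3 The stamp: (A)₂ for `293200be1` from ONE bit -/

/-- The census curve `293200be1`: `y² = x³ + x² − 3388217033x − 75912170159062` is an elliptic curve. -/
theorem isElliptic_293200be1' :
    (⟨0, ((1 : ℤ) : ℚ), 0, ((-3388217033 : ℤ) : ℚ), ((-75912170159062 : ℤ) : ℚ)⟩ : WeierstrassCurve ℚ).IsElliptic :=
  isElliptic_cubicModel _ _ _ (by simp only [Cubic.discr]; norm_num)

/-- **(A)₂ for `293200be1` from ONE parity bit (a `C1″-RES` row of GEN 4's census: `2 = 𝔭₁𝔭₂` in `ℚ(P)`, `d = 733`).** Granted `hLim2`;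
displayed: «`e_1 = 0` along the cyclotomic `ℤ₂`-extensions of `ℚ(θ)`», `θ` any root of `X³ − X² − 7X + 8`, i.e. `2 ∤ h(ℚ(θ, √2))` (census
`cyc6 = []`). KERNEL: `ℚ(P) = ℚ(β) = ℚ(θ)` with `β = −18802 − 18445θ + 4990θ²` a root of the `2`-division cubic and
`θ = (−2254304911498 − 33538753β + 998β²)/3125`; `2 ∤ d = 733`; `h(ℚ(θ)) = 1` (§1); Fukuda's index `0` and Thm. 1 (1).
[cite: Lim2017FineSelmer, §3 Thm. 3.5 and Lemma 3.2] [cite: Fukuda1994, Thm. 1 (1), p. 264] [cite: Cohen1993, App. B (d = 733)] -/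
theorem conjA_two_293200be1_of_layerOneBit
    (hLim2 : Lim2017.thm35_at_two_fineSelmerDual_moduleFinite_of_classicalMuVanishes_of_le_divisionField_four)
    {θ : AlgebraicClosure ℚ} (hθ : aeval θ (Cubic.toPoly ⟨1, ((-1 : ℤ) : ℚ), ((-7 : ℤ) : ℚ), ((8 : ℤ) : ℚ)⟩) = 0)
    (h1 : haveI : FiniteDimensional ℚ (IntermediateField.adjoin ℚ {θ}) :=
        IntermediateField.adjoin.finiteDimensional ((AlgebraicClosure.isAlgebraic ℚ).isAlgebraic θ).isIntegral
      haveI : NumberField (IntermediateField.adjoin ℚ {θ}) := NumberField.mk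
      ∀ κL : ZpExtension (IntermediateField.adjoin ℚ {θ}) 2, κL.IsCyclotomic → classNumberPExp κL 1 = 0)
    (κ : ZpExtension ℚ 2) (hκ : κ.IsCyclotomic) :
    haveI := isElliptic_293200be1'
    ∃ (γ : absoluteGaloisGroup ℚ) (D : (⟨0, ((1 : ℤ) : ℚ), 0, ((-3388217033 : ℤ) : ℚ), ((-75912170159062 : ℤ) : ℚ)⟩ :
        WeierstrassCurve ℚ).FineSelmerDualData κ γ),
      Module.Finite ℤ_[2] (RestrictScalars ℤ_[2] (IwasawaAlgebra 2) D.X) := by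
  haveI := isElliptic_293200be1'
  have hθ' : θ ^ 3 + (-1 : AlgebraicClosure ℚ) * θ ^ 2 + (-7 : AlgebraicClosure ℚ) * θ + (8 : AlgebraicClosure ℚ) = 0 := by
    have := hθ
    simp only [Cubic.toPoly, map_one, one_mul, aeval_add, aeval_mul, aeval_C, aeval_X_pow, aeval_X,
      eq_ratCast, Rat.cast_intCast] at this
    push_cast at this
    linear_combination this
  -- the root of the 2-division cubic inside ℚ(θ)
  set β : AlgebraicClosure ℚ := algebraMap ℚ (AlgebraicClosure ℚ) (-18802 : ℚ) +
      algebraMap ℚ (AlgebraicClosure ℚ) (-18445 : ℚ) * θ + algebraMap ℚ (AlgebraicClosure ℚ) (4990 : ℚ) * θ ^ 2 with hβdef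
  have hβ : aeval β (Cubic.toPoly ⟨1, ((1 : ℤ) : ℚ), ((-3388217033 : ℤ) : ℚ), ((-75912170159062 : ℤ) : ℚ)⟩) = 0 := by
    simp only [Cubic.toPoly, map_one, one_mul, aeval_add, aeval_mul, aeval_C, aeval_X_pow, aeval_X, eq_ratCast,
      Rat.cast_intCast]
    rw [hβdef]
    simp only [eq_ratCast]
    push_cast
    linear_combination ((-2356669106875 : AlgebraicClosure ℚ) + (3304738652250 : AlgebraicClosure ℚ) * θ +
      (-1253595534500 : AlgebraicClosure ℚ) * θ ^ 2 + (124251499000 : AlgebraicClosure ℚ) * θ ^ 3) * hθ'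
  have hadj : IntermediateField.adjoin ℚ {β} = IntermediateField.adjoin ℚ {θ} := by
    apply le_antisymm
    · rw [IntermediateField.adjoin_simple_le_iff, hβdef]
      have hθmem := IntermediateField.mem_adjoin_simple_self ℚ θ
      exact add_mem (add_mem (algebraMap_mem _ _) (mul_mem (algebraMap_mem _ _) hθmem))
        (mul_mem (algebraMap_mem _ _) (pow_mem hθmem 2))
    · rw [IntermediateField.adjoin_simple_le_iff]
      have hθeq : θ = algebraMap ℚ (AlgebraicClosure ℚ) (-2254304911498 / 3125 : ℚ) +
          algebraMap ℚ (AlgebraicClosure ℚ) (-33538753 / 3125 : ℚ) * β +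
          algebraMap ℚ (AlgebraicClosure ℚ) (998 / 3125 : ℚ) * β ^ 2 := by
        rw [hβdef]; simp only [eq_ratCast]; push_cast
        linear_combination (((1270901104 : AlgebraicClosure ℚ) / 25) + ((-994011992 : AlgebraicClosure ℚ) / 125) * θ) * hθ'
      rw [hθeq]
      have hβmem := IntermediateField.mem_adjoin_simple_self ℚ β
      exact add_mem (add_mem (algebraMap_mem _ _) (mul_mem (algebraMap_mem _ _) hβmem))
        (mul_mem (algebraMap_mem _ _) (pow_mem hβmem 2))
  obtain ⟨P₀, hP₀, hP₀eq⟩ := exists_geomTorsion_two_eq_some_root ((1 : ℤ) : ℚ) ((-3388217033 : ℤ) : ℚ)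
    ((-75912170159062 : ℤ) : ℚ) hβ
  have hF : IntermediateField.fixedField (MulAction.stabilizer (absoluteGaloisGroup ℚ) P₀) =
      IntermediateField.adjoin ℚ {θ} := by
    rw [fixedField_stabilizer_eq_adjoin_root _ _ _ hβ hP₀eq, ← hadj]
    -- the two `Algebra ℚ ℚ̄` instance paths agree
    congr 1
  exact fineSelmerDual_moduleFinite_two_of_odd_cubic_discr_pointField hLim2 _ hP₀ (p := -1) (q := -7) (r := 8)
    irreducible_cubic_disc_733 (by simp only [Cubic.discr]; norm_num) hθ hF
    (by rw [card_classGroup_adjoin_eq_one_disc_733 hθ]; norm_num) h1 κ hκ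

/-! ## §4 The second `𝔭₁𝔭₂` row: (A)₂ for `412992bw1` from TWO bits (field of discriminant `6453`) -/

/-- `X³ − 18X − 25` is irreducible over `ℚ` (no root mod `23`). -/
theorem irreducible_cubic_disc_6453 : Irreducible (Cubic.toPoly ⟨1, ((0 : ℤ) : ℚ), ((-18 : ℤ) : ℚ), ((-25 : ℤ) : ℚ)⟩) :=
  haveI : Fact (Nat.Prime 23) := ⟨by norm_num⟩
  irreducible_cubic_of_no_root_zmod 23 (by decide)

/-- The census curve `412992bw1`: `y² = x³ − 43798121268x − 3528022418672640` is an elliptic curve. -/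
theorem isElliptic_412992bw1' :
    (⟨0, ((0 : ℤ) : ℚ), 0, ((-43798121268 : ℤ) : ℚ), ((-3528022418672640 : ℤ) : ℚ)⟩ : WeierstrassCurve ℚ).IsElliptic :=
  isElliptic_cubicModel _ _ _ (by simp only [Cubic.discr]; norm_num)

/-- **(A)₂ for `412992bw1` from TWO parity bits (a `C1″-RES` row of GEN 4's census: `2 = 𝔭₁𝔭₂` in `ℚ(P)`, `d = 6453 = 3³·239`).**
Granted `hLim2`; displayed: `2 ∤ #Cl(𝓞 ℚ(θ))` (census `cyc3 = []`; in print `h = 1`) and «`e_1 = 0` along the cyclotomic `ℤ₂`-extensions of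
`ℚ(θ)`» = `2 ∤ h(ℚ(θ, √2))` (census `cyc6 = []`), `θ` any root of `X³ − 18X − 25` (disc `6453`, odd). KERNEL: `ℚ(P) = ℚ(β) = ℚ(θ)` with
`β = 433320 + 58826θ − 36110θ²` a root of the `2`-division cubic `X³ − 43798121268X − 3528022418672640` (disc `2⁸·…`, so the native
generator does not see that `2` is unramified) and `θ = (527183386329160 + 2181547162β − 18055β²)/1912`; Fukuda's index `0` and Thm. 1 (1).
[cite: Lim2017FineSelmer, §3 Thm. 3.5 and Lemma 3.2] [cite: Fukuda1994, Thm. 1 (1), p. 264] -/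
theorem conjA_two_412992bw1_of_twoBits
    (hLim2 : Lim2017.thm35_at_two_fineSelmerDual_moduleFinite_of_classicalMuVanishes_of_le_divisionField_four)
    {θ : AlgebraicClosure ℚ} (hθ : aeval θ (Cubic.toPoly ⟨1, ((0 : ℤ) : ℚ), ((-18 : ℤ) : ℚ), ((-25 : ℤ) : ℚ)⟩) = 0)
    (hh : ¬ 2 ∣ Nat.card (ClassGroup (𝓞 (IntermediateField.adjoin ℚ {θ}))))
    (h1 : haveI : FiniteDimensional ℚ (IntermediateField.adjoin ℚ {θ}) :=
        IntermediateField.adjoin.finiteDimensional ((AlgebraicClosure.isAlgebraic ℚ).isAlgebraic θ).isIntegral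
      haveI : NumberField (IntermediateField.adjoin ℚ {θ}) := NumberField.mk
      ∀ κL : ZpExtension (IntermediateField.adjoin ℚ {θ}) 2, κL.IsCyclotomic → classNumberPExp κL 1 = 0)
    (κ : ZpExtension ℚ 2) (hκ : κ.IsCyclotomic) :
    haveI := isElliptic_412992bw1'
    ∃ (γ : absoluteGaloisGroup ℚ) (D : (⟨0, ((0 : ℤ) : ℚ), 0, ((-43798121268 : ℤ) : ℚ), ((-3528022418672640 : ℤ) : ℚ)⟩ :
        WeierstrassCurve ℚ).FineSelmerDualData κ γ),
      Module.Finite ℤ_[2] (RestrictScalars ℤ_[2] (IwasawaAlgebra 2) D.X) := by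
  haveI := isElliptic_412992bw1'
  have hθ' : θ ^ 3 + (0 : AlgebraicClosure ℚ) * θ ^ 2 + (-18 : AlgebraicClosure ℚ) * θ + (-25 : AlgebraicClosure ℚ) = 0 := by
    have := hθ
    simp only [Cubic.toPoly, map_one, one_mul, aeval_add, aeval_mul, aeval_C, aeval_X_pow, aeval_X,
      eq_ratCast, Rat.cast_intCast] at this
    push_cast at this
    linear_combination this
  set β : AlgebraicClosure ℚ := algebraMap ℚ (AlgebraicClosure ℚ) (433320 : ℚ) +
      algebraMap ℚ (AlgebraicClosure ℚ) (58826 : ℚ) * θ + algebraMap ℚ (AlgebraicClosure ℚ) (-36110 : ℚ) * θ ^ 2 with hβdef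
  have hβ : aeval β (Cubic.toPoly ⟨1, ((0 : ℤ) : ℚ), ((-43798121268 : ℤ) : ℚ), ((-3528022418672640 : ℤ) : ℚ)⟩) = 0 := by
    simp only [Cubic.toPoly, map_one, one_mul, aeval_add, aeval_mul, aeval_C, aeval_X_pow, aeval_X, eq_ratCast,
      Rat.cast_intCast]
    rw [hβdef]
    simp only [eq_ratCast]
    push_cast
    linear_combination ((-2354249406553824 : AlgebraicClosure ℚ) + (472654008118920 : AlgebraicClosure ℚ) * θ +
      (230115329143800 : AlgebraicClosure ℚ) * θ ^ 2 + (-47084988131000 : AlgebraicClosure ℚ) * θ ^ 3) * hθ'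
  have hadj : IntermediateField.adjoin ℚ {β} = IntermediateField.adjoin ℚ {θ} := by
    apply le_antisymm
    · rw [IntermediateField.adjoin_simple_le_iff, hβdef]
      have hθmem := IntermediateField.mem_adjoin_simple_self ℚ θ
      exact add_mem (add_mem (algebraMap_mem _ _) (mul_mem (algebraMap_mem _ _) hθmem))
        (mul_mem (algebraMap_mem _ _) (pow_mem hθmem 2))
    · rw [IntermediateField.adjoin_simple_le_iff]
      have hθeq : θ = algebraMap ℚ (AlgebraicClosure ℚ) (65897923291145 / 239 : ℚ) +
          algebraMap ℚ (AlgebraicClosure ℚ) (1090773581 / 956 : ℚ) * β +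
          algebraMap ℚ (AlgebraicClosure ℚ) (-18055 / 1912 : ℚ) * β ^ 2 := by
        rw [hβdef]; simp only [eq_ratCast]; push_cast
        linear_combination (((-9588138714325 : AlgebraicClosure ℚ) / 239) + ((5885623516375 : AlgebraicClosure ℚ) / 478) * θ) * hθ'
      rw [hθeq]
      have hβmem := IntermediateField.mem_adjoin_simple_self ℚ β
      exact add_mem (add_mem (algebraMap_mem _ _) (mul_mem (algebraMap_mem _ _) hβmem))
        (mul_mem (algebraMap_mem _ _) (pow_mem hβmem 2))
  obtain ⟨P₀, hP₀, hP₀eq⟩ := exists_geomTorsion_two_eq_some_root ((0 : ℤ) : ℚ) ((-43798121268 : ℤ) : ℚ)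
    ((-3528022418672640 : ℤ) : ℚ) hβ
  have hF : IntermediateField.fixedField (MulAction.stabilizer (absoluteGaloisGroup ℚ) P₀) =
      IntermediateField.adjoin ℚ {θ} := by
    rw [fixedField_stabilizer_eq_adjoin_root _ _ _ hβ hP₀eq, ← hadj]
    -- the two `Algebra ℚ ℚ̄` instance paths agree
    congr 1
  exact fineSelmerDual_moduleFinite_two_of_odd_cubic_discr_pointField hLim2 _ hP₀ (p := 0) (q := -18) (r := -25)
    irreducible_cubic_disc_6453 (by simp only [Cubic.discr]; norm_num) hθ hF hh h1 κ hκ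

end Summit.BirchSwinnertonDyer.BirchSwinnertonDyer.Theorems.AddKatoTwo

end
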